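import Summits.CriticalPhenomena.CardyFormulaZ2.Theses.CardyRotToConf
import Literature.Topology.PlaneTopology.Crosscut
import HarnessLib

/-!
# Round germs of planar open sets: uniqueness of the germ disc
# (one-shot surgery for crux `CardyRotToConfR2SymmetryUpgrade`, stmt-CriticalPhenomena-0698)

Two algebraic facts on `ℂ` as a real inner product space and the predicate `IsRoundGerm U a m`
(`U` agrees near `a` with the open disc of centre `m` through `a`) with the uniqueness of the centre.
Negative lane: no Theses statement is asserted; overview in `Negative/OneShotSurgery.lean`.
-/

noncomputable section

open Set Filter Topology Metric
open scoped ComplexConjugate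

namespace Summit.CriticalPhenomena.CardyFormulaZ2.Theorems.CardyRotToConfR2SymmetryUpgrade.Negative

/-! ### Two algebraic facts on `ℂ` as a real inner product space -/

/-- `‖x + y‖² = ‖x‖² + 2 re (conj x * y) + ‖y‖²`. [folklore] -/
theorem norm_add_sq_complex (x y : ℂ) :
    ‖x + y‖ ^ 2 = ‖x‖ ^ 2 + 2 * (conj x * y).re + ‖y‖ ^ 2 := by
  rw [@norm_add_sq ℝ ℂ _ _ _ x y, Complex.inner, RCLike.re_to_real, mul_comm y]

/-- Probing vectors `t (I u) + c u` (`t`, `c` real) have squared norm `(t² + c²) ‖u‖²`.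
[folklore] -/
theorem norm_probe_sq (u : ℂ) (t c : ℝ) :
    ‖(t : ℂ) * (Complex.I * u) + (c : ℂ) * u‖ ^ 2 = (t ^ 2 + c ^ 2) * ‖u‖ ^ 2 := by
  rw [norm_add_sq_complex]
  have hcross : (conj ((t : ℂ) * (Complex.I * u)) * ((c : ℂ) * u)).re = 0 := by
    have e : conj ((t : ℂ) * (Complex.I * u)) * ((c : ℂ) * u) =
        ((t * c : ℝ) : ℂ) * (-Complex.I) * (conj u * u) := by
      simp only [map_mul, Complex.conj_ofReal, Complex.conj_I]
      push_cast
      ring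
    rw [e, ← Complex.normSq_eq_conj_mul_self]
    simp [Complex.mul_re]
  rw [hcross, mul_zero, add_zero, norm_mul, norm_mul, norm_mul, Complex.norm_real,
    Complex.norm_real, Complex.norm_I, one_mul, Real.norm_eq_abs, Real.norm_eq_abs, mul_pow,
    mul_pow, sq_abs, sq_abs]
  ring

/-- A vector orthogonal (real inner product) to `I u`, `u ≠ 0`, is a real multiple of `u`.
[folklore] -/
theorem exists_real_mul_of_orthogonal {u v : ℂ} (hu : u ≠ 0)
    (h : (conj (Complex.I * u) * v).re = 0) : ∃ μ : ℝ, v = (μ : ℂ) * u := by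
  have him : (conj u * v).im = 0 := by
    have e : (conj (Complex.I * u) * v).re = (conj u * v).im := by
      simp only [map_mul, Complex.conj_I]
      simp [Complex.mul_re, Complex.mul_im]
      ring
    rwa [e] at h
  have hreal : (((conj u * v).re : ℝ) : ℂ) = conj u * v :=
    Complex.ext (by simp) (by simp [him])
  have hcu : conj u * u = ((‖u‖ ^ 2 : ℝ) : ℂ) := by
    rw [← Complex.normSq_eq_conj_mul_self, Complex.normSq_eq_norm_sq]
  have hc : conj u ≠ 0 := (map_ne_zero_iff _ (RingHom.injective _)).2 hu
  refine ⟨(conj u * v).re / ‖u‖ ^ 2, ?_⟩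
  rw [Complex.ofReal_div, hreal, show (((‖u‖ ^ 2 : ℝ)) : ℂ) = conj u * u from hcu.symm]
  field_simp

/-! ### Round germs -/

/-- `U` has a **round germ at `a` with centre `m`**: `m ≠ a` and, in some ball around `a`, `U`
coincides with the open disc of centre `m` whose boundary circle passes through `a`.
[folklore] -/
def IsRoundGerm (U : Set ℂ) (a m : ℂ) : Prop :=
  m ≠ a ∧ ∃ r > 0, U ∩ ball a r = ball m (dist m a) ∩ ball a r

namespace IsRoundGerm

variable {U U' : Set ℂ} {a m m' : ℂ}

/-- `ne`: ne (auxiliary lemma of the one-shot surgery; the statement is the specification). -/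
theorem ne (h : IsRoundGerm U a m) : m ≠ a := h.1

/-- `dist_pos`: dist pos (auxiliary lemma of the one-shot surgery; the statement is the specification). -/
theorem dist_pos (h : IsRoundGerm U a m) : 0 < dist m a := _root_.dist_pos.2 h.1

/-- Shrinking the ball keeps the germ identity. [folklore] -/
theorem inter_ball_eq (h : IsRoundGerm U a m) :
    ∃ r > 0, ∀ r' ∈ Ioc 0 r, U ∩ ball a r' = ball m (dist m a) ∩ ball a r' := by
  obtain ⟨-, r, hr, hU⟩ := h
  refine ⟨r, hr, fun r' hr' => ?_⟩
  have hsub : ball a r' ⊆ ball a r := ball_subset_ball hr'.2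
  calc U ∩ ball a r' = (U ∩ ball a r) ∩ ball a r' := by
        rw [inter_assoc, inter_eq_right.2 hsub]
    _ = (ball m (dist m a) ∩ ball a r) ∩ ball a r' := by rw [hU]
    _ = ball m (dist m a) ∩ ball a r' := by rw [inter_assoc, inter_eq_right.2 hsub]

/-- The predicate only depends on the germ of the set: sets agreeing near `a` have the same round
germs. [folklore] -/
theorem congr_set (h : IsRoundGerm U a m) {ρ : ℝ} (hρ : 0 < ρ) (hUU' : U ∩ ball a ρ = U' ∩ ball a ρ) :
    IsRoundGerm U' a m := by
  obtain ⟨r, hr, hU⟩ := h.inter_ball_eq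
  refine ⟨h.ne, min r ρ, lt_min hr hρ, ?_⟩
  have hsub : ball a (min r ρ) ⊆ ball a ρ := ball_subset_ball (min_le_right _ _)
  rw [← hU _ ⟨lt_min hr hρ, min_le_left _ _⟩]
  calc U' ∩ ball a (min r ρ) = (U' ∩ ball a ρ) ∩ ball a (min r ρ) := by
        rw [inter_assoc, inter_eq_right.2 hsub]
    _ = (U ∩ ball a ρ) ∩ ball a (min r ρ) := by rw [hUU']
    _ = U ∩ ball a (min r ρ) := by rw [inter_assoc, inter_eq_right.2 hsub]

/-- Two round germs of the same set at the same point: the two discs coincide near `a`.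
[folklore] -/
theorem discs_agree (h : IsRoundGerm U a m) (h' : IsRoundGerm U a m') :
    ∃ r > 0, ball m (dist m a) ∩ ball a r = ball m' (dist m' a) ∩ ball a r := by
  obtain ⟨r₁, hr₁, h₁⟩ := h.inter_ball_eq
  obtain ⟨r₂, hr₂, h₂⟩ := h'.inter_ball_eq
  refine ⟨min r₁ r₂, lt_min hr₁ hr₂, ?_⟩
  rw [← h₁ _ ⟨lt_min hr₁ hr₂, min_le_left _ _⟩, ← h₂ _ ⟨lt_min hr₁ hr₂, min_le_right _ _⟩]

/-- **The centre of a round germ is unique**: two open discs through `a` that coincide near `a`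
are equal. Tangential probes `a ± t (I u)` force `m' - a ∥ m - a`, radial probes give the
orientation, parabolic probes `a + t (I u) + s u`, `s = t²/(1 + μ)`, separate internally tangent
discs of different radii. [folklore] -/
theorem unique (h : IsRoundGerm U a m) (h' : IsRoundGerm U a m') : m = m' := by
  obtain ⟨r, hr, heq⟩ := h.discs_agree h'
  set u : ℂ := m - a with hu_def
  have hu : u ≠ 0 := sub_ne_zero.2 h.ne
  have hRpos : 0 < ‖u‖ := norm_pos_iff.2 hu
  -- membership criteria for a point `a + z`
  have memD : ∀ z : ℂ, a + z ∈ ball m (dist m a) ↔ ‖z - u‖ < ‖u‖ := by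
    intro z
    rw [mem_ball, dist_eq_norm, dist_eq_norm, show a + z - m = z - u by rw [hu_def]; ring]
  have memD' : ∀ z : ℂ, a + z ∈ ball m' (dist m' a) ↔ ‖z - (m' - a)‖ < ‖m' - a‖ := by
    intro z
    rw [mem_ball, dist_eq_norm, dist_eq_norm, show a + z - m' = z - (m' - a) by ring]
  have memA : ∀ z : ℂ, a + z ∈ ball a r ↔ ‖z‖ < r := by
    intro z
    rw [mem_ball, dist_eq_norm, add_sub_cancel_left]
  have transfer : ∀ z : ℂ, ‖z‖ < r → (‖z - u‖ < ‖u‖ ↔ ‖z - (m' - a)‖ < ‖m' - a‖) := by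
    intro z hz
    rw [← memD, ← memD']
    constructor
    · intro hzD
      have : a + z ∈ ball m (dist m a) ∩ ball a r := ⟨hzD, (memA z).2 hz⟩
      rw [heq] at this
      exact this.1
    · intro hzD'
      have : a + z ∈ ball m' (dist m' a) ∩ ball a r := ⟨hzD', (memA z).2 hz⟩
      rw [← heq] at this
      exact this.1
  -- the probes `t (I u) + c u`
  obtain ⟨n, hn⟩ : ∃ n : ℂ, n = Complex.I * u := ⟨_, rfl⟩
  have hn_norm : ‖n‖ = ‖u‖ := by rw [hn, norm_mul, Complex.norm_I, one_mul]
  have hpos2 : 0 < ‖u‖ ^ 2 := pow_pos hRpos 2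
  have probe_norm : ∀ t c : ℝ, ‖(t : ℂ) * n + (c : ℂ) * u‖ ^ 2 = (t ^ 2 + c ^ 2) * ‖u‖ ^ 2 :=
    fun t c => by rw [hn]; exact norm_probe_sq u t c
  -- a probe lies in the first disc iff `t² + (c-1)² < 1`
  have inD : ∀ t c : ℝ, ‖(t : ℂ) * n + (c : ℂ) * u - u‖ < ‖u‖ ↔ t ^ 2 + (c - 1) ^ 2 < 1 := by
    intro t c
    have e : (t : ℂ) * n + (c : ℂ) * u - u = (t : ℂ) * n + ((c - 1 : ℝ) : ℂ) * u := by
      push_cast; ring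
    rw [e, ← sq_lt_sq₀ (norm_nonneg _) hRpos.le, probe_norm]
    constructor
    · intro h
      exact lt_of_mul_lt_mul_right (h.trans_eq (one_mul _).symm) hpos2.le
    · intro h
      calc (t ^ 2 + (c - 1) ^ 2) * ‖u‖ ^ 2 < 1 * ‖u‖ ^ 2 := mul_lt_mul_of_pos_right h hpos2
        _ = ‖u‖ ^ 2 := one_mul _
  -- Step 1: `m' - a` is a real multiple of `u`
  have orth : (conj n * (m' - a)).re = 0 := by
    set cc := (conj n * (m' - a)).re with hcc
    -- tangential probes `± t n` are outside the first disc (`t² + 1 ≥ 1`), hence outside the second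
    have key : ∀ t : ℝ, t ≠ 0 → |t| * ‖u‖ < r → 2 * t * cc ≤ t ^ 2 * ‖u‖ ^ 2 := by
      intro t ht htr
      have hz : ‖(t : ℂ) * n‖ < r := by
        rwa [norm_mul, Complex.norm_real, hn_norm, Real.norm_eq_abs]
      have hnotD : ¬ ‖(t : ℂ) * n - u‖ < ‖u‖ := by
        intro hlt
        have h2 : ‖(t : ℂ) * n - u‖ ^ 2 < ‖u‖ ^ 2 := by gcongr
        have e : (t : ℂ) * n - u = (t : ℂ) * n + ((-1 : ℝ) : ℂ) * u := by push_cast; ring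
        rw [e, probe_norm] at h2
        nlinarith [sq_nonneg t]
      have hnotD' : ¬ ‖(t : ℂ) * n - (m' - a)‖ < ‖m' - a‖ := fun hlt =>
        hnotD ((transfer _ hz).2 hlt)
      have hge : ‖m' - a‖ ^ 2 ≤ ‖(t : ℂ) * n - (m' - a)‖ ^ 2 := by
        have := not_lt.1 hnotD'
        gcongr
      have hsq : ‖(t : ℂ) * n - (m' - a)‖ ^ 2 =
          t ^ 2 * ‖u‖ ^ 2 - 2 * t * cc + ‖m' - a‖ ^ 2 := by
        rw [sub_eq_add_neg, norm_add_sq_complex, norm_neg]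
        have e2 : (conj ((t : ℂ) * n) * -(m' - a)).re = -(t * cc) := by
          rw [map_mul, Complex.conj_ofReal, hcc, mul_assoc, Complex.re_ofReal_mul, mul_neg,
            Complex.neg_re, mul_neg]
        rw [e2, norm_mul, Complex.norm_real, Real.norm_eq_abs, hn_norm, mul_pow, sq_abs]
        ring
      rw [hsq] at hge
      linarith
    by_contra hne
    have hcpos : 0 < |cc| := abs_pos.2 hne
    obtain ⟨t, ht0, ht1, ht2⟩ : ∃ t : ℝ, 0 < t ∧ t * ‖u‖ < r ∧ t * ‖u‖ ^ 2 < |cc| := by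
      refine ⟨min (r / (2 * ‖u‖)) (|cc| / (2 * ‖u‖ ^ 2)), lt_min (by positivity) (by positivity),
        ?_, ?_⟩
      · calc min (r / (2 * ‖u‖)) (|cc| / (2 * ‖u‖ ^ 2)) * ‖u‖ ≤ r / (2 * ‖u‖) * ‖u‖ := by
              gcongr; exact min_le_left _ _
          _ = r / 2 := by field_simp
          _ < r := by linarith
      · calc min (r / (2 * ‖u‖)) (|cc| / (2 * ‖u‖ ^ 2)) * ‖u‖ ^ 2
            ≤ |cc| / (2 * ‖u‖ ^ 2) * ‖u‖ ^ 2 := by gcongr; exact min_le_right _ _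
          _ = |cc| / 2 := by field_simp
          _ < |cc| := by linarith
    have k1 := key t ht0.ne' (by rwa [abs_of_pos ht0])
    have k2 := key (-t) (neg_ne_zero.2 ht0.ne') (by rwa [abs_neg, abs_of_pos ht0])
    have h3 : 2 * t * |cc| ≤ t ^ 2 * ‖u‖ ^ 2 := by
      rcases le_or_gt 0 cc with hc0 | hc0
      · rw [abs_of_nonneg hc0]; exact k1
      · rw [abs_of_neg hc0]; nlinarith
    have h4 : 2 * |cc| ≤ t * ‖u‖ ^ 2 :=
      le_of_mul_le_mul_left (by nlinarith [h3]) ht0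
    linarith
  obtain ⟨μ, hμ⟩ := exists_real_mul_of_orthogonal hu (by rw [← hn]; exact orth)
  have hμ0 : μ ≠ 0 := by
    rintro rfl
    simp only [Complex.ofReal_zero, zero_mul, sub_eq_zero] at hμ
    exact h'.ne hμ
  have hnorm' : ‖m' - a‖ = |μ| * ‖u‖ := by rw [hμ, norm_mul, Complex.norm_real, Real.norm_eq_abs]
  -- a probe lies in the second disc iff `t² + (c-μ)² < μ²`
  have inD' : ∀ t c : ℝ, ‖(t : ℂ) * n + (c : ℂ) * u - (m' - a)‖ < ‖m' - a‖ ↔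
      t ^ 2 + (c - μ) ^ 2 < μ ^ 2 := by
    intro t c
    have e : (t : ℂ) * n + (c : ℂ) * u - (m' - a) = (t : ℂ) * n + ((c - μ : ℝ) : ℂ) * u := by
      rw [hμ]; push_cast; ring
    have hpos : 0 < ‖m' - a‖ := by rw [hnorm']; positivity
    rw [e, ← sq_lt_sq₀ (norm_nonneg _) hpos.le, probe_norm, hnorm', mul_pow, sq_abs]
    constructor
    · intro h
      exact lt_of_mul_lt_mul_right h hpos2.le
    · intro h
      exact mul_lt_mul_of_pos_right h hpos2
  -- norm bound for probes: `‖t n + c u‖ ≤ (|t| + |c|) ‖u‖`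
  have probe_small : ∀ t c : ℝ, (|t| + |c|) * ‖u‖ < r → ‖(t : ℂ) * n + (c : ℂ) * u‖ < r := by
    intro t c htc
    calc ‖(t : ℂ) * n + (c : ℂ) * u‖ ≤ ‖(t : ℂ) * n‖ + ‖(c : ℂ) * u‖ := norm_add_le _ _
      _ = (|t| + |c|) * ‖u‖ := by
          rw [norm_mul, norm_mul, hn_norm, Complex.norm_real, Complex.norm_real, Real.norm_eq_abs,
            Real.norm_eq_abs]
          ring
      _ < r := htc
  -- Step 2: `μ > 0` (radial probes `c u`, `c` small positive, are in the first disc)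
  have hμpos : 0 < μ := by
    by_contra hle
    have hμneg : μ < 0 := lt_of_le_of_ne (not_lt.1 hle) hμ0
    obtain ⟨c, hc0, hc1, hcr⟩ : ∃ c : ℝ, 0 < c ∧ c < 1 ∧ c * ‖u‖ < r := by
      refine ⟨min (1 / 2) (r / (2 * ‖u‖)), lt_min (by norm_num) (by positivity),
        (min_le_left _ _).trans_lt (by norm_num), ?_⟩
      calc min (1 / 2) (r / (2 * ‖u‖)) * ‖u‖ ≤ r / (2 * ‖u‖) * ‖u‖ := by
            gcongr; exact min_le_right _ _
        _ = r / 2 := by field_simp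
        _ < r := by linarith
    have h1 : ‖((0 : ℝ) : ℂ) * n + (c : ℂ) * u - u‖ < ‖u‖ := by
      rw [inD]; nlinarith
    have hz : ‖((0 : ℝ) : ℂ) * n + (c : ℂ) * u‖ < r :=
      probe_small 0 c (by rwa [abs_zero, zero_add, abs_of_pos hc0])
    have h2 := (transfer _ hz).1 h1
    rw [inD'] at h2
    nlinarith
  -- Step 3: `μ = 1` (parabolic probes)
  have hμ1 : μ = 1 := by
    by_contra hμ1
    -- choose a small `t > 0`, set `s := t² / (1 + μ)`
    have h1μ : 0 < 1 + μ := by linarith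
    obtain ⟨t, ht0, htr, hts⟩ : ∃ t : ℝ, 0 < t ∧ (t + t ^ 2 / (1 + μ)) * ‖u‖ < r ∧
        t ^ 2 / (1 + μ) < |1 - μ| := by
      have hd : 0 < |1 - μ| := abs_pos.2 (sub_ne_zero.2 (Ne.symm hμ1))
      -- `t := min (1/2) (min (r / (4 ‖u‖)) (|1-μ| (1+μ) / 2))`-type choice; use `t ≤ 1`, `t² ≤ t`
      set t := min 1 (min (r / (4 * ‖u‖)) (|1 - μ| * (1 + μ) / 2)) with ht
      have ht0 : 0 < t := lt_min one_pos (lt_min (by positivity) (by positivity))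
      have ht1 : t ≤ 1 := min_le_left _ _
      have htr : t ≤ r / (4 * ‖u‖) := (min_le_right _ _).trans (min_le_left _ _)
      have htd : t ≤ |1 - μ| * (1 + μ) / 2 := (min_le_right _ _).trans (min_le_right _ _)
      have hsq : t ^ 2 ≤ t := by nlinarith
      refine ⟨t, ht0, ?_, ?_⟩
      · have hs : t ^ 2 / (1 + μ) ≤ t := by
          rw [div_le_iff₀ h1μ]; nlinarith
        calc (t + t ^ 2 / (1 + μ)) * ‖u‖ ≤ (t + t) * ‖u‖ := by gcongr
          _ ≤ (r / (4 * ‖u‖) + r / (4 * ‖u‖)) * ‖u‖ := by gcongr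
          _ = r / 2 := by field_simp; ring
          _ < r := by linarith
      · rw [div_lt_iff₀ h1μ]
        nlinarith
    set s := t ^ 2 / (1 + μ) with hs
    have hs0 : 0 < s := by positivity
    have hts2 : t ^ 2 = (1 + μ) * s := by rw [hs]; field_simp
    have hz : ‖(t : ℂ) * n + (s : ℂ) * u‖ < r :=
      probe_small t s (by rwa [abs_of_pos ht0, abs_of_pos hs0])
    have key := transfer _ hz
    rw [inD, inD'] at key
    -- `t² + (s-1)² < 1 ↔ s < 1 - μ` and `t² + (s-μ)² < μ² ↔ s < μ - 1`
    rcases lt_or_gt_of_ne hμ1 with hlt | hgt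
    · -- `μ < 1`: in the first disc, not in the second
      have hin : t ^ 2 + (s - 1) ^ 2 < 1 := by
        rw [abs_of_pos (by linarith : (0:ℝ) < 1 - μ)] at hts
        nlinarith
      have hout : ¬ t ^ 2 + (s - μ) ^ 2 < μ ^ 2 := by nlinarith
      exact hout (key.1 hin)
    · -- `μ > 1`: in the second disc, not in the first
      have hin : t ^ 2 + (s - μ) ^ 2 < μ ^ 2 := by
        rw [abs_of_neg (by linarith : (1:ℝ) - μ < 0)] at hts
        nlinarith
      have hout : ¬ t ^ 2 + (s - 1) ^ 2 < 1 := by nlinarith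
      exact hout (key.2 hin)
  -- conclusion
  rw [hμ1, Complex.ofReal_one, one_mul, hu_def] at hμ
  linear_combination -hμ

end IsRoundGerm

end Summit.CriticalPhenomena.CardyFormulaZ2.Theorems.CardyRotToConfR2SymmetryUpgrade.Negative
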